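import Summits.AtomisticToContinuum.HydrodynamicLimit.Theorems.LambertianContactSwapSwapGapEntropyTools
import Summits.AtomisticToContinuum.HydrodynamicLimit.Theorems.LambertianContactSwapSwapGapGibbsDomination
import Summits.AtomisticToContinuum.HydrodynamicLimit.Theorems.LambertianContactSwapLambertianEulerGibbsInvariance
import Summits.AtomisticToContinuum.HydrodynamicLimit.Theorems.LambertianContactSwapSwapGapDominatedKL
import HarnessLib

/-!
# `SwapGap` (stmt-AtomisticToContinuum-11850), line `Sketch`: entropy relative to the Lambertian law — exact decomposition and the `O(N)` budget

Helper file (`--supports`) for the crux `…Theses.LambertianContactSwap.SwapGap`, line `Sketch` (entropy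
relative to the Lambertian law), stub S1 (`RelEntSwap`): pre-shock, `KL(p_t ‖ q_t) / (N+1) → 0`, where
`p_t = (Φ_t)_* P_N` (deterministic hard-sphere flow from the local Gibbs law `P_N`) and
`q_t = (Λ_t)_* (P_N ⊗ γ^ℕ)` (Lambertian cosine-law flow from the same law).

Granted the `Λ`-invariance of `liouville ⊗ γ^ℕ` (the registered stub `stub_liouvilleInvariance` of
the sibling crux `LambertianEuler`, stmt-AtomisticToContinuum-11854, taken as the hypothesis `hLI`),
for continuous profiles and `0 < σ < 1/2` the main theorem
`klDiv_map_flow_map_lambertFlow_decomposition` gives, with `G_N = localGibbsLaw σ 1 0 1 N Φ` the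
standard homogeneous Gibbs law and `h_t = llr q_t G_N` the log-likelihood of the Lambertian law,
for EVERY `N`, every flow `Φ` and every `t ≥ 0`:

* `KL(p_t ‖ q_t) < ∞` and `KL(q_t ‖ G_N) < ∞`; `h_t` is `p_t`- and `q_t`-integrable;
* the EXACT DECOMPOSITION `KL(p_t ‖ q_t) = KL(P_N ‖ G_N) - ∫ h_t dp_t`, i.e.
  `KL(p_t ‖ q_t) = [KL(P_N ‖ G_N) - KL(q_t ‖ G_N)] + [∫ h_t dq_t - ∫ h_t dp_t]`
  — entropy-production deficit of the Lambertian gas plus the likelihood gap between the two laws;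
* the LOSCHMIDT-ECHO form `KL(p_t ‖ q_t) = KL(P_N ‖ (Φ_{-t})_* q_t)` (`klDiv_map_flow_map_lambertFlow_eq_echo`:
  S1 ⟺ the Lambertian-forward / deterministic-backward echo returns `P_N` to itself up to `o(N)` entropy);
* the BUDGET `KL(p_t ‖ q_t) ≤ (2 + b) A · (N + 1)`: S1's quantity is finite and `O(N)` UNIFORMLY IN
  TIME — never of the order of the expected number of collisions `≍ σ² t (N+1)^{4/3}` (the question
  the previous lead put to the disprover); S1 is exactly the claim that this `O(N)` is `o(N)` pre-shock,
  and by the decomposition S1 ⟺ [Λ-adiabaticity `KL(P_N ‖ G_N) - KL(q_t ‖ G_N) = o(N)`] ∧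
  [likelihood gap `∫ h_t d(q_t - p_t) = o(N)`] (both brackets are bounded by `O(N)`; the first is
  `≥ 0` by data processing).

Mechanism (`llr_ae_of_dominated` / `integral_llr_eq_of_dominated` / `toReal_klDiv_eq_of_dominated`,
pure measure theory, file `…SwapGapDominatedKL`): if `μ ≪ G` and `G · e^{-V} ≤ ν ≤ G · e^{W}`, then `dμ/dν = dμ/dG · dG/dν`
with `e^{-W} ≤ dG/dν ≤ e^{V}`, so `llr μ ν = llr μ G - llr ν G`, `-V ≤ llr ν G ≤ W`, and
`KL(μ ‖ ν) = KL(μ ‖ G) - ∫ llr ν G dμ ≤ KL(μ ‖ G) + ∫ V dμ`.  Inputs: the static two-sided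
energy-tilted domination `G_N e^{-(A(N+1)+bE)} ≤ P_N ≤ G_N e^{A(N+1)+bE}` with `KL(P_N ‖ G_N) ≤ A(N+1)`,
`E_{P_N}[E] ≤ A(N+1)` (`…SwapGapGibbsDomination.exists_localGibbsLaw_dominated`); its TRANSPORT ALONG
`Λ` (`map_prod_withDensity_energy_lambertFlow_eq`: every energy tilt `G_N · F(E)` is `Λ`-invariant,
since `G_N ⊗ γ^ℕ` is — `gibbsInvariance_of_liouvilleInvariance` — and the kinetic energy is conserved
along `Λ` almost surely — `ae_lambertNoise_forall_configEnergy_lambertFlow_hsDiameter`; push-forwards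
are monotone); on the deterministic side the pinned entropy `KL(p_t ‖ G_N) = KL(P_N ‖ G_N)`
(`klDiv_map_flow_localGibbsLaw_const`) and energy conservation on the good set (`configEnergy_flow`).

Kipnis–Landim 1999, Ch. 6 §1; Olla–Varadhan–Yau 1993 §3.  prover-line-stmt-AtomisticToContinuum-11850-c1-0, cycle 2.
-/

noncomputable section

open MeasureTheory Filter Set Topology InformationTheory
open scoped ENNReal

namespace Summit.AtomisticToContinuum.HydrodynamicLimit.Theorems.LambertianContactSwapSwapGapRelEntBudget

open Literature.Analysis.FluidPDE Literature.MathematicalPhysics.KineticTheory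
open Summit.AtomisticToContinuum.HydrodynamicLimit.Theorems
open Summit.AtomisticToContinuum.HydrodynamicLimit.Theorems.LambertianContactSwapLambertianEulerGibbsInvariance
open Summit.AtomisticToContinuum.HydrodynamicLimit.Theorems.LambertianContactSwapSwapGapGibbsDomination
open Summit.AtomisticToContinuum.HydrodynamicLimit.Theorems.LambertianContactSwapSwapGapDominatedKL

/-! ### Part C — the Lambertian law at time `t` is two-sidedly dominated by the reference -/

/-- Monotonicity of `μ ↦ (μ ⊗ κ) ∘ f⁻¹` in the first factor. [folklore] -/
theorem map_prod_mono_left {α β γ : Type*} [MeasurableSpace α] [MeasurableSpace β]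
    [MeasurableSpace γ] {μ₁ μ₂ : Measure α} (h : μ₁ ≤ μ₂) (κ : Measure β) [SFinite κ]
    {f : α × β → γ} (hf : Measurable f) : (μ₁.prod κ).map f ≤ (μ₂.prod κ).map f := by
  refine Measure.le_iff.2 fun s hs => ?_
  rw [Measure.map_apply hf hs, Measure.map_apply hf hs, Measure.prod_apply (hf hs),
    Measure.prod_apply (hf hs)]
  exact lintegral_mono' h le_rfl

/-- **Energy tilts of the standard homogeneous Gibbs law are `Λ`-invariant**: for every measurable
`F` of the kinetic energy `E`, `0 < σ < 1/2`, `N`, `Φ` (type-fixing) and `t ≥ 0`,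
`((G_N · F(E)) ⊗ γ^ℕ) ∘ Λ_t⁻¹ = G_N · F(E)`, granted the `Λ`-invariance of `liouville ⊗ γ^ℕ`
(`G_N ⊗ γ^ℕ` is then `Λ`-invariant, `gibbsInvariance_of_liouvilleInvariance`, and the kinetic
energy is conserved along `Λ` almost surely, `ae_lambertNoise_forall_configEnergy_lambertFlow_hsDiameter`).
[folklore] -/
theorem map_prod_withDensity_energy_lambertFlow_eq
    (hLI : ∀ ε : ℝ, 0 < ε → ε < 2⁻¹ → ∀ (N : ℕ) (t : ℝ), 0 ≤ t →
      ((liouville (Torus.geometry (Fin 3)) N ε).prod (lambertNoise (Fin 3))).map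
          (fun p => lambertFlow (Torus.geometry (Fin 3)) ε p.2 p.1 t) =
        liouville (Torus.geometry (Fin 3)) N ε)
    {σ : ℝ} (hσ : 0 < σ) (hσ' : σ < 2⁻¹) (N : ℕ)
    (Φ : HardSphereFlow (Torus.geometry (Fin 3)) (hsDiameter σ N) (N + 1)) {t : ℝ} (ht : 0 ≤ t)
    {F : ℝ → ℝ≥0∞} (hF : Measurable F) :
    (((localGibbsLaw σ (fun _ => 1) (fun _ => 0) (fun _ => 1) N Φ).withDensity
        (fun z => F (configEnergy z))).prod (lambertNoise (Fin 3))).map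
        (fun p => lambertFlow (Torus.geometry (Fin 3)) (hsDiameter σ N) p.2 p.1 t) =
      (localGibbsLaw σ (fun _ => 1) (fun _ => 0) (fun _ => 1) N Φ).withDensity
        (fun z => F (configEnergy z)) := by
  set Gr := localGibbsLaw σ (fun _ => (1 : ℝ)) (fun _ => (0 : V3)) (fun _ => (1 : ℝ)) N Φ with hGr
  have hΛ : Measurable fun p : Config (N + 1) (Fin 3) T3 × (ℕ → V3) =>
      lambertFlow (Torus.geometry (Fin 3)) (hsDiameter σ N) p.2 p.1 t :=
    measurable_lambertFlow_hsDiameter hσ.le hσ' N t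
  have hinv := gibbsInvariance_of_liouvilleInvariance hLI hσ hσ' N 1 1 0 Φ ht
  have hEm : Measurable (configEnergy : Config (N + 1) (Fin 3) T3 → ℝ) := by
    unfold configEnergy
    exact measurable_const.mul
      (Finset.measurable_sum _ fun i _ => ((measurable_pi_apply i).snd).norm.pow_const 2)
  have hgm : Measurable fun z : Config (N + 1) (Fin 3) T3 => F (configEnergy z) := hF.comp hEm
  -- energy conservation almost surely under `Gr ⊗ γ^ℕ` (every datum, a.e. noise; Fubini)
  have hae : ∀ᵐ p ∂(Gr.prod (lambertNoise (Fin 3))),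
      F (configEnergy p.1) =
        F (configEnergy (lambertFlow (Torus.geometry (Fin 3)) (hsDiameter σ N) p.2 p.1 t)) := by
    refine (Measure.ae_prod_iff_ae_ae ?_).2 (ae_of_all _ fun z =>
      (ae_lambertNoise_forall_configEnergy_lambertFlow_hsDiameter hσ.le hσ' N z).mono
        fun ξs h => by rw [h t])
    exact measurableSet_eq_fun (hgm.comp measurable_fst) (hgm.comp hΛ)
  rw [prod_withDensity_left hgm, map_withDensity_of_ae_eq hΛ hgm hae, hinv]

/-- **Transport of dominations along `Λ`.** If `G_N · F₁(E) ≤ P ≤ G_N · F₂(E)` for measurable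
functions `F₁, F₂` of the kinetic energy, then for `t ≥ 0` the law `q_t` of `Λ_t` under `P ⊗ γ^ℕ`
satisfies `G_N · F₁(E) ≤ q_t ≤ G_N · F₂(E)` (energy tilts are `Λ`-invariant and push-forwards are
monotone), granted the `Λ`-invariance of `liouville ⊗ γ^ℕ`. [folklore] -/
theorem withDensity_le_map_prod_lambertFlow_le_withDensity
    (hLI : ∀ ε : ℝ, 0 < ε → ε < 2⁻¹ → ∀ (N : ℕ) (t : ℝ), 0 ≤ t →
      ((liouville (Torus.geometry (Fin 3)) N ε).prod (lambertNoise (Fin 3))).map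
          (fun p => lambertFlow (Torus.geometry (Fin 3)) ε p.2 p.1 t) =
        liouville (Torus.geometry (Fin 3)) N ε)
    {σ : ℝ} (hσ : 0 < σ) (hσ' : σ < 2⁻¹) (N : ℕ)
    (Φ : HardSphereFlow (Torus.geometry (Fin 3)) (hsDiameter σ N) (N + 1)) {t : ℝ} (ht : 0 ≤ t)
    {P : Measure (Config (N + 1) (Fin 3) T3)} {F₁ F₂ : ℝ → ℝ≥0∞} (hF₁ : Measurable F₁)
    (hF₂ : Measurable F₂)
    (h₁ : (localGibbsLaw σ (fun _ => 1) (fun _ => 0) (fun _ => 1) N Φ).withDensity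
      (fun z => F₁ (configEnergy z)) ≤ P)
    (h₂ : P ≤ (localGibbsLaw σ (fun _ => 1) (fun _ => 0) (fun _ => 1) N Φ).withDensity
      (fun z => F₂ (configEnergy z))) :
    (localGibbsLaw σ (fun _ => 1) (fun _ => 0) (fun _ => 1) N Φ).withDensity
        (fun z => F₁ (configEnergy z)) ≤
      (P.prod (lambertNoise (Fin 3))).map
        (fun p => lambertFlow (Torus.geometry (Fin 3)) (hsDiameter σ N) p.2 p.1 t) ∧
    (P.prod (lambertNoise (Fin 3))).map
        (fun p => lambertFlow (Torus.geometry (Fin 3)) (hsDiameter σ N) p.2 p.1 t) ≤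
      (localGibbsLaw σ (fun _ => 1) (fun _ => 0) (fun _ => 1) N Φ).withDensity
        (fun z => F₂ (configEnergy z)) := by
  have hΛ : Measurable fun p : Config (N + 1) (Fin 3) T3 × (ℕ → V3) =>
      lambertFlow (Torus.geometry (Fin 3)) (hsDiameter σ N) p.2 p.1 t :=
    measurable_lambertFlow_hsDiameter hσ.le hσ' N t
  constructor
  · calc _ = _ := (map_prod_withDensity_energy_lambertFlow_eq hLI hσ hσ' N Φ ht hF₁).symm
      _ ≤ _ := map_prod_mono_left h₁ _ hΛ
  · calc _ ≤ _ := map_prod_mono_left h₂ _ hΛ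
      _ = _ := map_prod_withDensity_energy_lambertFlow_eq hLI hσ hσ' N Φ ht hF₂


/-! ### Part C′ — the Loschmidt-echo form of S1's entropy -/

/-- **Loschmidt-echo form of the entropy relative to a law carried by the good set** (any hard-sphere
flow `Φ`, finite laws): if `P` and `q` give no mass to the bad set, then
`KL((Φ_t)_* P ‖ q) = KL(P ‖ (Φ_{-t})_* q)` — transport of both arguments by the measurable inverse
`Φ_{-t}` of `Φ_t` on the good set (`klDiv_map_eq_of_leftInvOn`).  With `q = q_t` the Lambertian law,
`(Φ_{-t})_* q_t` is the law of the ECHO `Φ_{-t} ∘ Λ_t` (Lambertian gas forward for time `t`, then the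
deterministic dynamics backward for time `t`) started from `P_N`: S1 says that the echo returns the
local Gibbs law to itself up to `o(N)` relative entropy. [folklore] -/
theorem klDiv_map_flow_eq_klDiv_map_flow_neg {d : Type*} [Fintype d] {X : Type*} [MeasureSpace X]
    [TopologicalSpace X] {G : Geometry d X} {ε : ℝ} {n : ℕ} (Φ : HardSphereFlow G ε n)
    (P q : Measure (Config n d X)) [IsFiniteMeasure P] [IsFiniteMeasure q]
    (hP : P Φ.goodᶜ = 0) (hq : q Φ.goodᶜ = 0) (t : ℝ) :
    klDiv (P.map (Φ.flow t)) q = klDiv P (q.map (Φ.flow (-t))) := by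
  have hgood : ∀ᵐ z ∂q, z ∈ Φ.good := by rw [ae_iff]; exact hq
  have hq' : (q.map (Φ.flow (-t))).map (Φ.flow t) = q := by
    rw [Measure.map_map (Φ.measurable_flow t) (Φ.measurable_flow (-t)),
      Measure.map_congr (show (Φ.flow t ∘ Φ.flow (-t)) =ᵐ[q] id from
        hgood.mono fun z hz => Φ.flow_flow_neg t hz), Measure.map_id]
  haveI : IsFiniteMeasure (q.map (Φ.flow (-t))) := Measure.isFiniteMeasure_map _ _
  have hbA : (q.map (Φ.flow (-t))) Φ.goodᶜ = 0 := by
    rw [Measure.map_apply (Φ.measurable_flow (-t)) Φ.measurableSet_good.compl]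
    refine measure_mono_null (fun z hz => ?_) hq
    intro hzg
    exact hz (Φ.mapsTo_good (-t) hzg)
  conv_lhs => rw [← hq']
  exact Literature.MathematicalPhysics.StatisticalMechanics.klDiv_map_eq_of_leftInvOn
    (Φ.measurable_flow t) (Φ.measurable_flow (-t)) Φ.measurableSet_good hP hbA
    (fun z hz => Φ.flow_neg_flow t hz)

/-! ### Part D — the entropy budget relative to the Lambertian law, and the exact decomposition -/

/-- **ENTROPY RELATIVE TO THE LAMBERTIAN LAW: EXACT DECOMPOSITION AND BUDGET** (S1 infrastructure
for the crux `LambertianContactSwap.SwapGap`, stmt-AtomisticToContinuum-11850, line `Sketch`;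
S1 = `stub_relEntSwap` asks that `KL(p_t ‖ q_t)` be `o(N)` pre-shock, where
`p_t = (Φ_t)_* P_N` and `q_t = (Λ_t)_* (P_N ⊗ γ^ℕ)`). Granted the `Λ`-invariance of
`liouville ⊗ γ^ℕ` (crux stmt-11854's registered stub `stub_liouvilleInvariance`), for continuous
profiles `a₀, θ₀ > 0`, `u₀` and `0 < σ < 1/2` there are `A, b ≥ 0` such that for EVERY `N`, every
hard-sphere flow `Φ` and every `t ≥ 0`, with `G_N = localGibbsLaw σ 1 0 1 N Φ` the standard
homogeneous Gibbs law and `h_t = llr q_t G_N` the log-likelihood of the Lambertian law: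
(a) `KL(p_t ‖ q_t) < ∞`; (b) `h_t` is `p_t`- and `q_t`-integrable with `|h_t| ≤ A(N+1) + b E` a.e.;
(c) the EXACT decomposition `KL(p_t ‖ q_t) = KL(P_N ‖ G_N) - ∫ h_t dp_t`
  `= [KL(P_N ‖ G_N) - KL(q_t ‖ G_N)] + [∫ h_t dq_t - ∫ h_t dp_t]`
(entropy-production deficit of `Λ` plus likelihood gap; `KL(q_t ‖ G_N) = ∫ h_t dq_t`);
(d) the BUDGET `KL(p_t ‖ q_t) ≤ (2 + b) A (N+1)` — finite and `O(N)` uniformly in time (never of the order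
of the expected number of collisions `≍ σ² t (N+1)^{4/3}`).  Mechanism: `G_N e^{-A(N+1)-bE} ≤ q_t ≤
G_N e^{A(N+1)+bE}` (static domination of `P_N`, transported along `Λ`), `KL(p_t ‖ G_N) = KL(P_N ‖ G_N)
≤ A(N+1)` (pinned entropy), `E_{p_t}[E] = E_{P_N}[E] ≤ A(N+1)` (energy conservation along `Φ`).
[cite: KipnisLandim1999, Ch. 6 §1] -/
theorem klDiv_map_flow_map_lambertFlow_decomposition
    (hLI : ∀ ε : ℝ, 0 < ε → ε < 2⁻¹ → ∀ (N : ℕ) (t : ℝ), 0 ≤ t →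
      ((liouville (Torus.geometry (Fin 3)) N ε).prod (lambertNoise (Fin 3))).map
          (fun p => lambertFlow (Torus.geometry (Fin 3)) ε p.2 p.1 t) =
        liouville (Torus.geometry (Fin 3)) N ε)
    {a₀ θ₀ : T3 → ℝ} {u₀ : T3 → V3} (ha : Continuous a₀) (hθ : Continuous θ₀)
    (hu : Continuous u₀) (ha0 : ∀ x, 0 < a₀ x) (hθ0 : ∀ x, 0 < θ₀ x) {σ : ℝ} (hσ : 0 < σ)
    (hσ' : σ < 2⁻¹) :
    ∃ A b : ℝ, 0 ≤ A ∧ 0 ≤ b ∧ ∀ (N : ℕ)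
      (Φ : HardSphereFlow (Torus.geometry (Fin 3)) (hsDiameter σ N) (N + 1)) (t : ℝ), 0 ≤ t →
      klDiv ((localGibbsLaw σ a₀ u₀ θ₀ N Φ).map (Φ.flow t))
          (((localGibbsLaw σ a₀ u₀ θ₀ N Φ).prod (lambertNoise (Fin 3))).map
            (fun p => lambertFlow (Torus.geometry (Fin 3)) (hsDiameter σ N) p.2 p.1 t)) ≠ ∞ ∧
      klDiv (((localGibbsLaw σ a₀ u₀ θ₀ N Φ).prod (lambertNoise (Fin 3))).map
            (fun p => lambertFlow (Torus.geometry (Fin 3)) (hsDiameter σ N) p.2 p.1 t))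
          (localGibbsLaw σ (fun _ => 1) (fun _ => 0) (fun _ => 1) N Φ) ≠ ∞ ∧
      Integrable (llr (((localGibbsLaw σ a₀ u₀ θ₀ N Φ).prod (lambertNoise (Fin 3))).map
            (fun p => lambertFlow (Torus.geometry (Fin 3)) (hsDiameter σ N) p.2 p.1 t))
          (localGibbsLaw σ (fun _ => 1) (fun _ => 0) (fun _ => 1) N Φ))
        ((localGibbsLaw σ a₀ u₀ θ₀ N Φ).map (Φ.flow t)) ∧
      Integrable (llr (((localGibbsLaw σ a₀ u₀ θ₀ N Φ).prod (lambertNoise (Fin 3))).map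
            (fun p => lambertFlow (Torus.geometry (Fin 3)) (hsDiameter σ N) p.2 p.1 t))
          (localGibbsLaw σ (fun _ => 1) (fun _ => 0) (fun _ => 1) N Φ))
        (((localGibbsLaw σ a₀ u₀ θ₀ N Φ).prod (lambertNoise (Fin 3))).map
            (fun p => lambertFlow (Torus.geometry (Fin 3)) (hsDiameter σ N) p.2 p.1 t)) ∧
      (klDiv ((localGibbsLaw σ a₀ u₀ θ₀ N Φ).map (Φ.flow t))
          (((localGibbsLaw σ a₀ u₀ θ₀ N Φ).prod (lambertNoise (Fin 3))).map
            (fun p => lambertFlow (Torus.geometry (Fin 3)) (hsDiameter σ N) p.2 p.1 t))).toReal =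
        (klDiv (localGibbsLaw σ a₀ u₀ θ₀ N Φ)
            (localGibbsLaw σ (fun _ => 1) (fun _ => 0) (fun _ => 1) N Φ)).toReal -
          ∫ z, llr (((localGibbsLaw σ a₀ u₀ θ₀ N Φ).prod (lambertNoise (Fin 3))).map
              (fun p => lambertFlow (Torus.geometry (Fin 3)) (hsDiameter σ N) p.2 p.1 t))
            (localGibbsLaw σ (fun _ => 1) (fun _ => 0) (fun _ => 1) N Φ) z
            ∂((localGibbsLaw σ a₀ u₀ θ₀ N Φ).map (Φ.flow t)) ∧
      (klDiv (((localGibbsLaw σ a₀ u₀ θ₀ N Φ).prod (lambertNoise (Fin 3))).map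
            (fun p => lambertFlow (Torus.geometry (Fin 3)) (hsDiameter σ N) p.2 p.1 t))
          (localGibbsLaw σ (fun _ => 1) (fun _ => 0) (fun _ => 1) N Φ)).toReal =
        ∫ z, llr (((localGibbsLaw σ a₀ u₀ θ₀ N Φ).prod (lambertNoise (Fin 3))).map
              (fun p => lambertFlow (Torus.geometry (Fin 3)) (hsDiameter σ N) p.2 p.1 t))
            (localGibbsLaw σ (fun _ => 1) (fun _ => 0) (fun _ => 1) N Φ) z
            ∂(((localGibbsLaw σ a₀ u₀ θ₀ N Φ).prod (lambertNoise (Fin 3))).map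
              (fun p => lambertFlow (Torus.geometry (Fin 3)) (hsDiameter σ N) p.2 p.1 t)) ∧
      klDiv (localGibbsLaw σ a₀ u₀ θ₀ N Φ)
          (localGibbsLaw σ (fun _ => 1) (fun _ => 0) (fun _ => 1) N Φ) ≤
        ENNReal.ofReal (A * ((N : ℝ) + 1)) ∧
      klDiv ((localGibbsLaw σ a₀ u₀ θ₀ N Φ).map (Φ.flow t))
          (((localGibbsLaw σ a₀ u₀ θ₀ N Φ).prod (lambertNoise (Fin 3))).map
            (fun p => lambertFlow (Torus.geometry (Fin 3)) (hsDiameter σ N) p.2 p.1 t)) ≤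
        ENNReal.ofReal ((2 + b) * A * ((N : ℝ) + 1)) := by
  have hσ2 : σ ≤ 1 / 2 := by rw [one_div]; exact hσ'.le
  obtain ⟨A, b, hA, hb, hdom⟩ := exists_localGibbsLaw_dominated ha hθ hu ha0 hθ0 hσ2
  refine ⟨A, b, hA, hb, fun N Φ t ht => ?_⟩
  obtain ⟨h1, h2, h3, hEi, hEint⟩ := hdom N Φ
  set P := localGibbsLaw σ a₀ u₀ θ₀ N Φ with hPdef
  set Gr := localGibbsLaw σ (fun _ => (1 : ℝ)) (fun _ => (0 : V3)) (fun _ => (1 : ℝ)) N Φ with hGdef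
  have hΛ : Measurable fun p : Config (N + 1) (Fin 3) T3 × (ℕ → V3) =>
      lambertFlow (Torus.geometry (Fin 3)) (hsDiameter σ N) p.2 p.1 t :=
    measurable_lambertFlow_hsDiameter hσ.le hσ' N t
  haveI : IsProbabilityMeasure P := isProbabilityMeasure_localGibbsLaw ha hθ hu ha0 hθ0 hσ2 N Φ
  haveI : IsProbabilityMeasure Gr := isProbabilityMeasure_localGibbsLaw (a₀ := fun _ => (1 : ℝ))
    (θ₀ := fun _ => (1 : ℝ)) (u₀ := fun _ => (0 : V3)) continuous_const continuous_const
    continuous_const (fun _ => one_pos) (fun _ => one_pos) hσ2 N Φ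
  set μ := P.map (Φ.flow t) with hμ
  set ν := (P.prod (lambertNoise (Fin 3))).map
    (fun p => lambertFlow (Torus.geometry (Fin 3)) (hsDiameter σ N) p.2 p.1 t) with hν
  haveI : IsProbabilityMeasure μ := Measure.isProbabilityMeasure_map (Φ.measurable_flow t).aemeasurable
  haveI : IsProbabilityMeasure ν := Measure.isProbabilityMeasure_map hΛ.aemeasurable
  -- `μ ≪ Gr` and the pinned entropy
  have hPG : P ≪ Gr := (Measure.absolutelyContinuous_of_le h1).trans (withDensity_absolutelyContinuous _ _)
  have hGinv : Gr.map (Φ.flow t) = Gr := map_flow_localGibbsLaw_const σ 1 1 0 N Φ t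
  have hμG : μ ≪ Gr := by
    have h := hPG.map (Φ.measurable_flow t)
    rwa [hGinv] at h
  have hklμ : klDiv μ Gr = klDiv P Gr :=
    klDiv_map_flow_localGibbsLaw_const hσ2 ha hθ hu ha0 hθ0 one_pos one_pos 0 N Φ t
  have hfin : klDiv μ Gr ≠ ∞ := by
    rw [hklμ]
    exact ne_top_of_le_ne_top ENNReal.ofReal_ne_top h3
  -- the tilt `V = A(N+1) + b E`: measurable, integrable under `μ` and `ν` with mean `≤ 2A(N+1)`
  set V : Config (N + 1) (Fin 3) T3 → ℝ := fun z => A * ((N : ℝ) + 1) + b * configEnergy z with hV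
  have hEm : Measurable (configEnergy : Config (N + 1) (Fin 3) T3 → ℝ) := by
    unfold configEnergy
    exact measurable_const.mul
      (Finset.measurable_sum _ fun i _ => ((measurable_pi_apply i).snd).norm.pow_const 2)
  have hVm : Measurable V := (measurable_const.mul hEm).const_add _
  have hPL : P ≪ liouville (Torus.geometry (Fin 3)) (N + 1) (hsDiameter σ N) :=
    withDensity_absolutelyContinuous _ _
  have hgood : ∀ᵐ z ∂P, z ∈ Φ.good := by
    have h : P Φ.goodᶜ = 0 := measure_compl_good_eq_zero_of_absolutelyContinuous Φ hPL
    rw [ae_iff]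
    exact h
  have hEflow : (fun z => configEnergy (Φ.flow t z)) =ᵐ[P] configEnergy :=
    hgood.mono fun z hz => Φ.configEnergy_flow hz t
  have hEiμ : Integrable (configEnergy : Config (N + 1) (Fin 3) T3 → ℝ) μ := by
    rw [hμ, integrable_map_measure hEm.aestronglyMeasurable (Φ.measurable_flow t).aemeasurable]
    exact hEi.congr hEflow.symm
  have hViμ : Integrable V μ := (integrable_const _).add (hEiμ.const_mul b)
  have hVint : ∫ z, V z ∂μ ≤ A * ((N : ℝ) + 1) + b * (A * ((N : ℝ) + 1)) := by
    rw [hV, integral_add (integrable_const _) (hEiμ.const_mul b), integral_const, probReal_univ,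
      one_smul, integral_const_mul]
    have hE : ∫ z, configEnergy z ∂μ = ∫ z, configEnergy z ∂P := by
      rw [hμ, integral_map (Φ.measurable_flow t).aemeasurable hEm.aestronglyMeasurable]
      exact integral_congr_ae hEflow
    rw [hE]
    exact add_le_add le_rfl (mul_le_mul_of_nonneg_left hEint hb)
  -- energy conservation along `Λ`: `V ∘ Λ_t = V ∘ fst` almost surely under `P ⊗ γ^ℕ`
  have hEΛ : ∀ᵐ p ∂(P.prod (lambertNoise (Fin 3))),
      configEnergy (lambertFlow (Torus.geometry (Fin 3)) (hsDiameter σ N) p.2 p.1 t) =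
        configEnergy p.1 := by
    refine (Measure.ae_prod_iff_ae_ae ?_).2 (ae_of_all _ fun z =>
      (ae_lambertNoise_forall_configEnergy_lambertFlow_hsDiameter hσ.le hσ' N z).mono
        fun ξs h => h t)
    exact measurableSet_eq_fun (hEm.comp hΛ) (hEm.comp measurable_fst)
  have hEiν : Integrable (configEnergy : Config (N + 1) (Fin 3) T3 → ℝ) ν := by
    rw [hν, integrable_map_measure hEm.aestronglyMeasurable hΛ.aemeasurable]
    exact (hEi.comp_fst (lambertNoise (Fin 3))).congr (hEΛ.mono fun p hp => hp.symm)
  have hViν : Integrable V ν := (integrable_const _).add (hEiν.const_mul b)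
  -- the two dominations of the Lambertian law
  obtain ⟨hlow, hup⟩ := withDensity_le_map_prod_lambertFlow_le_withDensity hLI hσ hσ' N Φ ht
    (P := P) (F₁ := fun e => ENNReal.ofReal (Real.exp (-(A * ((N : ℝ) + 1) + b * e))))
    (F₂ := fun e => ENNReal.ofReal (Real.exp (A * ((N : ℝ) + 1) + b * e)))
    ((Real.measurable_exp.comp ((measurable_const.mul measurable_id).const_add _).neg).ennreal_ofReal)
    ((Real.measurable_exp.comp ((measurable_const.mul measurable_id).const_add _)).ennreal_ofReal)
    h2 h1
  -- the abstract decomposition with `μ = p_t`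
  obtain ⟨hfinν, hiμ, heq, hle⟩ := toReal_klDiv_eq_of_dominated hμG hfin hVm hViμ hViμ hlow hup
  -- for `q_t` itself: `llr q_t G ∈ [-V, V]` a.e., hence integrable, hence `KL(q_t ‖ G) = ∫ h dq_t`
  have hνG : ν ≪ Gr :=
    (Measure.absolutelyContinuous_of_le hup).trans (withDensity_absolutelyContinuous _ _)
  obtain ⟨-, hbdν, -⟩ := llr_ae_of_dominated (μ := ν) hνG hVm hlow hup
  have hiν : Integrable (llr ν Gr) ν := by
    refine Integrable.mono' hViν (measurable_llr _ _).aestronglyMeasurable ?_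
    filter_upwards [hbdν] with x hx
    rw [Real.norm_eq_abs]
    exact abs_le.2 hx
  have hfinνG : klDiv ν Gr ≠ ∞ := klDiv_ne_top hνG hiν
  have heqν : (klDiv ν Gr).toReal = ∫ z, llr ν Gr z ∂ν := toReal_klDiv_of_measure_eq hνG (by simp)
  refine ⟨hfinν, hfinνG, hiμ, hiν, ?_, heqν, h3, ?_⟩
  · rw [heq, hklμ]
  · rw [← ENNReal.ofReal_toReal hfinν]
    refine ENNReal.ofReal_le_ofReal ?_
    have hklP : (klDiv μ Gr).toReal ≤ A * ((N : ℝ) + 1) := by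
      rw [hklμ]
      exact ENNReal.toReal_le_of_le_ofReal (by positivity) h3
    have hN : (0 : ℝ) ≤ (N : ℝ) + 1 := by positivity
    nlinarith [mul_nonneg hb (mul_nonneg hA hN)]


/-- **S1's entropy in Loschmidt-echo form** (granted the `Λ`-invariance of `liouville ⊗ γ^ℕ`): for
continuous profiles, `0 < σ < 1/2`, every `N`, `Φ`, `t ≥ 0`,
`KL(p_t ‖ q_t) = KL(P_N ‖ (Φ_{-t})_* q_t)`, the law `(Φ_{-t})_* q_t` being that of the echo
`Φ_{-t}(Λ_t(z, ξs))`, `z ∼ P_N` (the Lambertian law `q_t` is carried by the good set because it is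
dominated by an energy tilt of the homogeneous Gibbs law). So S1 ⟺ the Lambertian-forward /
deterministic-backward echo returns the local Gibbs law to itself up to `o(N)` relative entropy.
[folklore] -/
theorem klDiv_map_flow_map_lambertFlow_eq_echo
    (hLI : ∀ ε : ℝ, 0 < ε → ε < 2⁻¹ → ∀ (N : ℕ) (t : ℝ), 0 ≤ t →
      ((liouville (Torus.geometry (Fin 3)) N ε).prod (lambertNoise (Fin 3))).map
          (fun p => lambertFlow (Torus.geometry (Fin 3)) ε p.2 p.1 t) =
        liouville (Torus.geometry (Fin 3)) N ε)
    {a₀ θ₀ : T3 → ℝ} {u₀ : T3 → V3} (ha : Continuous a₀) (hθ : Continuous θ₀)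
    (hu : Continuous u₀) (ha0 : ∀ x, 0 < a₀ x) (hθ0 : ∀ x, 0 < θ₀ x) {σ : ℝ} (hσ : 0 < σ)
    (hσ' : σ < 2⁻¹) (N : ℕ) (Φ : HardSphereFlow (Torus.geometry (Fin 3)) (hsDiameter σ N) (N + 1))
    {t : ℝ} (ht : 0 ≤ t) :
    klDiv ((localGibbsLaw σ a₀ u₀ θ₀ N Φ).map (Φ.flow t))
        (((localGibbsLaw σ a₀ u₀ θ₀ N Φ).prod (lambertNoise (Fin 3))).map
          (fun p => lambertFlow (Torus.geometry (Fin 3)) (hsDiameter σ N) p.2 p.1 t)) =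
      klDiv (localGibbsLaw σ a₀ u₀ θ₀ N Φ)
        ((((localGibbsLaw σ a₀ u₀ θ₀ N Φ).prod (lambertNoise (Fin 3))).map
          (fun p => lambertFlow (Torus.geometry (Fin 3)) (hsDiameter σ N) p.2 p.1 t)).map
          (Φ.flow (-t))) := by
  have hσ2 : σ ≤ 1 / 2 := by rw [one_div]; exact hσ'.le
  obtain ⟨A, b, -, -, hdom⟩ := exists_localGibbsLaw_dominated ha hθ hu ha0 hθ0 hσ2
  obtain ⟨h1, h2, -, -, -⟩ := hdom N Φ
  set P := localGibbsLaw σ a₀ u₀ θ₀ N Φ with hPdef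
  haveI : IsProbabilityMeasure P := isProbabilityMeasure_localGibbsLaw ha hθ hu ha0 hθ0 hσ2 N Φ
  have hΛ : Measurable fun p : Config (N + 1) (Fin 3) T3 × (ℕ → V3) =>
      lambertFlow (Torus.geometry (Fin 3)) (hsDiameter σ N) p.2 p.1 t :=
    measurable_lambertFlow_hsDiameter hσ.le hσ' N t
  haveI : IsProbabilityMeasure ((P.prod (lambertNoise (Fin 3))).map
      (fun p => lambertFlow (Torus.geometry (Fin 3)) (hsDiameter σ N) p.2 p.1 t)) :=
    Measure.isProbabilityMeasure_map hΛ.aemeasurable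
  -- both laws are carried by the good set: they are below Liouville
  have hPL : P ≪ liouville (Torus.geometry (Fin 3)) (N + 1) (hsDiameter σ N) :=
    withDensity_absolutelyContinuous _ _
  have hGL : localGibbsLaw σ (fun _ => (1 : ℝ)) (fun _ => (0 : V3)) (fun _ => (1 : ℝ)) N Φ ≪
      liouville (Torus.geometry (Fin 3)) (N + 1) (hsDiameter σ N) :=
    withDensity_absolutelyContinuous _ _
  obtain ⟨-, hup⟩ := withDensity_le_map_prod_lambertFlow_le_withDensity hLI hσ hσ' N Φ ht
    (P := P) (F₁ := fun e => ENNReal.ofReal (Real.exp (-(A * ((N : ℝ) + 1) + b * e))))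
    (F₂ := fun e => ENNReal.ofReal (Real.exp (A * ((N : ℝ) + 1) + b * e)))
    ((Real.measurable_exp.comp ((measurable_const.mul measurable_id).const_add _).neg).ennreal_ofReal)
    ((Real.measurable_exp.comp ((measurable_const.mul measurable_id).const_add _)).ennreal_ofReal)
    h2 h1
  have hqL := ((Measure.absolutelyContinuous_of_le hup).trans
    (withDensity_absolutelyContinuous _ _)).trans hGL
  exact klDiv_map_flow_eq_klDiv_map_flow_neg Φ P _
    (measure_compl_good_eq_zero_of_absolutelyContinuous Φ hPL)
    (measure_compl_good_eq_zero_of_absolutelyContinuous Φ hqL) t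

end Summit.AtomisticToContinuum.HydrodynamicLimit.Theorems.LambertianContactSwapSwapGapRelEntBudget

end
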